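import Mathlib
import Summits.Ventures.HodgeRepro2.T6NAut3
import Summits.Ventures.HodgeRepro2.T6N5Rich

/-!
# T6N5RichSH — the (S–H) residual of the rich N5 datum closed through N2: the diagonal-restriction
dictionary from the N2 datum's line characters to the N5 letters makes `RichData.SH` a theorem of
`N2Datum.HChi` (proved on the composition carrier by `M.AdmDatum`, the conclusion of N2)

Tier 6 (README §10), sub-step N5 of the M2 discharge (t6-p7).  In `T6N5Rich` condition (a) of Theorem 5.6 on
side B reduces to the one equation `RichData.SH : rA = rB` — «(χ_{111}χ_{100})|_Δ = (χ_{101}χ_{110})|_Δ»,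
TIER5 §N5.5(b) / N2 (A5), «the χ-part of seam S–H».  On t6-p5's N2 datum (`T6N2Datum`) the four line
characters are carried in the group `Char` with `χ₁₀₁ := χ₁₁₁`, `χ₁₁₀ := χ₁₀₀` (the choice of record, TIER5
N2.2.10), and (H_χ) is the field-level statement `N2Datum.HChi : χ₁₁₁ * χ₁₀₀ = χ₁₀₁ * χ₁₁₀` (a conjunct of
`N2Datum.Adm` = the carrier's `AdmDatum`, proved in the M2 composition by `N2ToyIso.N2_main_explicit`).  The
N5 letters `rA`, `rB` are the restrictions of the products to the diagonal E¹_Δ(𝔸) ⊂ E¹ × E¹: a group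
homomorphism `dict` from the N2 characters to the N5 character group with `rA = dict (χ₁₁₁ · χ₁₀₀)` and
`rB = dict (χ₁₀₁ · χ₁₁₀)` — two construction facts of the datum (class EX: the N5 sides are BUILT from the N2
characters).  With them, `SH` follows from (H_χ) (`SH_of_dict`), and on the carrier from `M.AdmDatum`
(`SH_of_admDatum`): in a re-cut composition the binder `hSH` of `N5RichMain.N5_of_rich` is replaced by
`(dict) (hA) (hB)` and the already-consumed `N2_main_explicit …`.

§8(d): uses an L-value-free non-vanishing device: NO.
-/

namespace Summit.Ventures.HodgeRepro2.T6.N5RichSH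

open Summit.Ventures.HodgeRepro2.T6.N5Rich

section CarrierFree

variable {ι G : Type*} [CommGroup G]

/-- (S–H) from (H_χ) through the diagonal-restriction dictionary: if the N5 letters `rA`, `rB` are the
images under a homomorphism `dict` of the products of the line characters of the two sides, and the products
agree ((H_χ)), then `rA = rB`. -/
theorem SH_of_dict (R : RichData ι G) {H : Type*} [CommGroup H] (dict : H →* G)
    {χ₁₁₁ χ₁₀₀ χ₁₀₁ χ₁₁₀ : H} (hχ : χ₁₁₁ * χ₁₀₀ = χ₁₀₁ * χ₁₁₀)
    (hA : R.rA = dict (χ₁₁₁ * χ₁₀₀)) (hB : R.rB = dict (χ₁₀₁ * χ₁₁₀)) : R.SH := by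
  unfold RichData.SH
  rw [hA, hB, hχ]

/-- (S–H) from t6-p5's N2 datum: the dictionary to the N2 datum's `χ₁₁₁`, `χ₁₀₀`, `χ₁₀₁`, `χ₁₁₀` and
`N2Datum.HChi` give `RichData.SH`. -/
theorem SH_of_N2Datum {K : Type*} [Field K] [NumberField K] [NumberField.IsCMField K]
    {F : FaceSetting K} {P : NDatum F} {𝒟 : N3Datum} (D : N2Datum F P 𝒟) (R : RichData ι G)
    (dict : D.Char →* G) (hA : R.rA = dict (D.χ₁₁₁ * D.χ₁₀₀)) (hB : R.rB = dict (D.χ₁₀₁ * D.χ₁₁₀))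
    (hχ : D.HChi) : R.SH :=
  SH_of_dict R dict hχ hA hB

end CarrierFree

section Carrier

variable {K : Type*} [Field K] [NumberField K] [NumberField.IsCMField K] {F : FaceSetting K}
  {P : NDatum F}

/-- (S–H) ON THE CARRIER from N2's conclusion: for a rich N5 datum whose letters `rA`, `rB` are the
diagonal restrictions (through `dict`) of the products of the carrier's N2 line characters, `M.AdmDatum`
(μ-admissibility, `W_B ≅ W_A`, (H_χ)) gives `R.SH` — the binder `hSH` of `N5RichMain.N5_of_rich` from the
N2 main already consumed by the composition. -/
theorem SH_of_admDatum (M : NAut3 F P) (R : RichData M.ι5 M.G5) (dict : M.d2.Char →* M.G5)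
    (hA : R.rA = dict (M.d2.χ₁₁₁ * M.d2.χ₁₀₀)) (hB : R.rB = dict (M.d2.χ₁₀₁ * M.d2.χ₁₁₀))
    (hN2 : M.AdmDatum) : R.SH :=
  SH_of_N2Datum M.d2 R dict hA hB hN2.2.2

end Carrier

end Summit.Ventures.HodgeRepro2.T6.N5RichSH
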